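import Mathlib
import Literature.Analysis.FluidPDE.TypeIICoreWitness
import Literature.Analysis.FluidPDE.AncientMildWeakStar
import Summits.NavierStokesRegularity.NavierStokesRegularity.Theorems.TypeIIInviscidRelaxationMonopoleCoreExclusionAnchorObstructionGeometry
import HarnessLib

/-!
# Crux `MonopoleCoreExclusion` (stmt-1965): kinematic obstruction for the anchor stub of the AXISYMMETRIC class —
# core lengths of axisymmetric witnesses of a "core + spoiler shell" slice are bounded by the shell radius

`--supports stmt-NavierStokesRegularity-1965` (helper file, negative side; theorems only, no definitions, no `sorry`;
outside the import cone of the route file).  Twin of `…CoreExclusionAnchorObstruction` (columnar class, p832090).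

For the COLUMNAR class a compactly supported slice already bounds the core length of every witness (translation
along the axis leaves the support).  For the AXISYMMETRIC class this fails: an exactly axisymmetric compact core
admits witnesses of every core length (the orbits of `rotZ` are bounded circles).  The obstruction needs a SPOILER:
here the slice is an axisymmetric cone core `V·max(0, 1 - ‖x‖/a)·e_z` (axis `e_z` through the origin) plus a thick
spherical shell `D ≤ ‖x‖ ≤ 2D` carrying the constant field `(V/3)·e_x` (`D ≥ 4a`), zero elsewhere.  Then
(`MonopoleAnchorObstruction.mul_sub_one_lt_of_shellSpoiler`) EVERY datum `(x₀, L, V', Q, W)` satisfying the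
speed-bound, near-maximum and level-`K` closeness clauses with an AXISYMMETRIC profile `W`, `K ≥ 25`, has
`L·(K - 1) < 2D`.  Proof (all elementary, in the witness frame): (1) AXIS PINNING — the antipode `rotZ π y₁` of the
rescaled near-maximum point has the same profile size (`‖W (rotZ π y)‖ = ‖W y‖`), so its physical image must stay
in the core: the witness axis passes within `a` of the near-maximum point; (2) if `L(K-1) ≥ 2D` the axis meets the
shell inside the `K`-ball, and ON the axis an axisymmetric profile is vertical, so the shell direction `Q⁻¹e_x` is
`6/K`-close to vertical; (3) at the near-maximum point and its antipode the profile is `≈ γ·Q⁻¹e_z` with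
`γ ≥ 1/2`, and `rotZ π` flips horizontal components, so `Q⁻¹e_z` is `4/K`-close to vertical too — impossible for two
orthonormal vectors when `K ≥ 25`.

The companion file `…MonopoleCoreExclusionAnchorObstructionFamily` turns this into the explicit time-dependent family
(axisymmetric witnesses at every level frequently, non-Type-I growth, never late, no radius floor).  Nothing about
Navier–Stokes is claimed; no stub or crux is proved or refuted here.
-/

noncomputable section

open Set Metric
open Literature.Analysis Literature.Analysis.FluidPDE

namespace Summit.NavierStokesRegularity.NavierStokesRegularity.Theorems

-- the problem directory repeats the summit name (`NavierStokesRegularity/NavierStokesRegularity`)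
set_option linter.dupNamespace false

namespace MonopoleAnchorObstruction

/-- `‖e_z‖ = 1` (file-local copy). [folklore] -/
private theorem norm_eZ' : ‖(eZ : EuclideanSpace ℝ (Fin 3))‖ = 1 := by
  simp [eZ]

/-! ### §4 The obstruction: axisymmetric witnesses of a core-plus-shell slice have bounded core length -/

/-- **Kinematic obstruction for the axisymmetric class.**  Let the slice `f : ℝ³ → ℝ³` be the axisymmetric cone
core `f x = V·max(0, 1 - ‖x‖/a)·e_z` on `‖x‖ ≤ a`, zero on `a < ‖x‖ < D`, the constant spoiler `(V/3)·e_x` on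
the shell `D ≤ ‖x‖ ≤ 2D`, and zero beyond, with `0 < a`, `4a ≤ D`, `0 < V`.  Then every datum `(x₀, L, V', Q, W)`
with `W` AXISYMMETRIC satisfying the speed-bound clause `‖f‖ ≤ V'`, the near-maximum clause and the level-`K`
closeness clause `‖V'⁻¹Q⁻¹f(x₀ + LQy) - W y‖ ≤ K⁻¹` on `‖y‖ ≤ K`, with `K ≥ 25`, has core length
`L·(K - 1) < 2D`.  (Axis pinning by the antipode `rotZ π`; on-axis verticality of axisymmetric profiles at a shell
point of the axis; horizontal flip at the near-maximum point; two orthonormal vectors cannot both be `O(1/K)`-close to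
vertical.) [folklore] -/
theorem mul_sub_one_lt_of_shellSpoiler
    {f : EuclideanSpace ℝ (Fin 3) → EuclideanSpace ℝ (Fin 3)} {a D V : ℝ}
    (ha : 0 < a) (hV : 0 < V) (hDa : 4 * a ≤ D)
    (f1 : ∀ x, ‖x‖ ≤ a → f x = (V * max 0 (1 - ‖x‖ / a)) • (eZ : EuclideanSpace ℝ (Fin 3)))
    (f2 : ∀ x, a < ‖x‖ → ‖x‖ < D → f x = 0)
    (f3 : ∀ x, D ≤ ‖x‖ → ‖x‖ ≤ 2 * D → f x = (V / 3) • EuclideanSpace.single 0 1)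
    (f4 : ∀ x, 2 * D < ‖x‖ → f x = 0)
    {K L Vw : ℝ} {x₀ : EuclideanSpace ℝ (Fin 3)}
    {Q : EuclideanSpace ℝ (Fin 3) ≃ₗᵢ[ℝ] EuclideanSpace ℝ (Fin 3)}
    {W : EuclideanSpace ℝ (Fin 3) → EuclideanSpace ℝ (Fin 3)}
    (hK : 25 ≤ K) (hL : 0 < L) (hVw : 0 < Vw) (hW : IsAxisymmetric W)
    (hbd : ∀ x, ‖f x‖ ≤ Vw) (hnear : ∃ x₁, dist x₁ x₀ ≤ L ∧ Vw ≤ 2 * ‖f x₁‖)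
    (hclose : ∀ y : EuclideanSpace ℝ (Fin 3), ‖y‖ ≤ K →
      ‖Vw⁻¹ • Q.symm (f (x₀ + L • Q y)) - W y‖ ≤ K⁻¹) :
    L * (K - 1) < 2 * D := by
  have hD : 0 < D := by linarith
  have hK0 : 0 < K := by linarith
  have hK1 : (1 : ℝ) ≤ K := by linarith
  have hKinv : K⁻¹ ≤ 25⁻¹ := inv_anti₀ (by norm_num) hK
  obtain ⟨hfle, hoff, hf0⟩ := shellSpoiler_sizes ha hV f1 f2 f3 f4
  -- `V ≤ Vw ≤ 2V`
  have hVwV : V ≤ Vw := by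
    have h := hbd 0
    rwa [hf0, norm_smul, norm_eZ', mul_one, Real.norm_of_nonneg hV.le] at h
  obtain ⟨x₁, hx₁, hVx₁⟩ := hnear
  have hVw2 : Vw ≤ 2 * V := hVx₁.trans (by linarith only [hfle x₁])
  -- the near-maximum point lies in the inner half of the core
  have hx₁a : ‖x₁‖ ≤ a := by
    by_contra h
    have := hoff x₁ (not_le.1 h)
    linarith only [this, hVwV, hVx₁, hVw]
  have hfx₁ : f x₁ = (V * max 0 (1 - ‖x₁‖ / a)) • (eZ : EuclideanSpace ℝ (Fin 3)) := f1 x₁ hx₁a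
  set g₁ : ℝ := max 0 (1 - ‖x₁‖ / a) with hg₁
  have hg₁0 : 0 ≤ g₁ := le_max_left _ _
  have hnfx₁ : ‖f x₁‖ = V * g₁ := by
    rw [hfx₁, norm_smul, norm_eZ', mul_one, Real.norm_of_nonneg (mul_nonneg hV.le hg₁0)]
  have hVg₁ : Vw ≤ 2 * (V * g₁) := by rw [← hnfx₁]; exact hVx₁
  have hg₁half : 2⁻¹ ≤ g₁ := by
    by_contra h
    have h' : V * g₁ < V * 2⁻¹ := mul_lt_mul_of_pos_left (not_le.1 h) hV
    linarith only [h', hVg₁, hVwV]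
  have hx₁half : ‖x₁‖ ≤ a / 2 := by
    have h : 2⁻¹ ≤ 1 - ‖x₁‖ / a := by
      rcases le_max_iff.1 (hg₁half.trans_eq hg₁) with h | h
      · norm_num at h
      · exact h
    have h' : ‖x₁‖ / a ≤ 2⁻¹ := by linarith only [h]
    rw [div_le_iff₀ ha] at h'
    linarith only [h']
  -- the witness frame: rescaled near-maximum point, rescaled centre, the two unit vectors
  set y₁ : EuclideanSpace ℝ (Fin 3) := L⁻¹ • Q.symm (x₁ - x₀) with hy₁
  set yc : EuclideanSpace ℝ (Fin 3) := L⁻¹ • Q.symm (0 - x₀) with hyc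
  have hphys₁ : x₀ + L • Q y₁ = x₁ := by
    rw [hy₁, map_smul, smul_smul, mul_inv_cancel₀ hL.ne', one_smul, Q.apply_symm_apply]
    abel
  have hphysc : x₀ + L • Q yc = 0 := by
    rw [hyc, map_smul, smul_smul, mul_inv_cancel₀ hL.ne', one_smul, Q.apply_symm_apply]
    abel
  have hny₁ : ‖y₁‖ ≤ 1 := by
    rw [hy₁, norm_smul, Real.norm_of_nonneg (inv_nonneg.2 hL.le), LinearIsometryEquiv.norm_map,
      ← dist_eq_norm]
    calc L⁻¹ * dist x₁ x₀ ≤ L⁻¹ * L := mul_le_mul_of_nonneg_left hx₁ (inv_nonneg.2 hL.le)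
      _ = 1 := inv_mul_cancel₀ hL.ne'
  have hyc₁ : ‖yc - y₁‖ ≤ a / (2 * L) := by
    have h : yc - y₁ = L⁻¹ • Q.symm (-x₁) := by
      rw [hyc, hy₁, ← smul_sub, ← map_sub]
      congr 2
      abel
    rw [h, norm_smul, Real.norm_of_nonneg (inv_nonneg.2 hL.le), LinearIsometryEquiv.norm_map, norm_neg]
    calc L⁻¹ * ‖x₁‖ ≤ L⁻¹ * (a / 2) := mul_le_mul_of_nonneg_left hx₁half (inv_nonneg.2 hL.le)
      _ = a / (2 * L) := by field_simp
  clear_value y₁ yc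
  set aa : EuclideanSpace ℝ (Fin 3) := Q.symm eZ with haa_def
  set b : EuclideanSpace ℝ (Fin 3) := Q.symm (EuclideanSpace.single 0 1) with hb_def
  have haa : ‖aa‖ = 1 := by rw [haa_def, LinearIsometryEquiv.norm_map, norm_eZ']
  have hb : ‖b‖ = 1 := by rw [hb_def, LinearIsometryEquiv.norm_map]; simp
  have hab : ‖aa - b‖ ^ 2 = 2 := by
    rw [haa_def, hb_def, ← map_sub, LinearIsometryEquiv.norm_map, norm_eZ_sub_single_zero_sq]
  -- closeness at `y₁` in vector form, `γ₁ ≥ 1/2`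
  set γ₁ : ℝ := Vw⁻¹ * (V * g₁) with hγ₁
  have hγ₁half : 2⁻¹ ≤ γ₁ := by rw [hγ₁, le_inv_mul_iff₀ hVw]; linarith only [hVg₁]
  have hc₁ : ‖γ₁ • aa - W y₁‖ ≤ K⁻¹ := by
    have h := hclose y₁ (hny₁.trans hK1)
    rwa [hphys₁, hfx₁, map_smul, smul_smul] at h
  have hWy₁ : 2⁻¹ - K⁻¹ ≤ ‖W y₁‖ := by
    have h := norm_sub_norm_le (γ₁ • aa) (W y₁)
    rw [norm_smul, haa, mul_one, Real.norm_of_nonneg (by linarith only [hγ₁half])] at h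
    linarith only [h, hc₁, hγ₁half]
  -- the antipode of the near-maximum point
  set y₁' : EuclideanSpace ℝ (Fin 3) := rotZ Real.pi y₁ with hy₁'
  have hny₁' : ‖y₁'‖ ≤ 1 := by rw [hy₁', norm_rotZ]; exact hny₁
  have hWrot : W y₁' = rotZ Real.pi (W y₁) := hW Real.pi y₁
  have hnW' : ‖W y₁'‖ = ‖W y₁‖ := by rw [hWrot, norm_rotZ]
  set x₁' : EuclideanSpace ℝ (Fin 3) := x₀ + L • Q y₁' with hx₁'
  have hdist' : dist x₁' x₁ = 2 * L * cylRadius y₁ := by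
    rw [hx₁', ← hphys₁, dist_eq_norm, add_sub_add_left_eq_sub, ← smul_sub, norm_smul, ← map_sub,
      LinearIsometryEquiv.norm_map, hy₁', norm_rotZ_pi_sub, Real.norm_of_nonneg hL.le]
    ring
  -- STEP 1: axis pinning, `L · r(y₁) ≤ a`
  have hpin : L * cylRadius y₁ ≤ a := by
    by_contra h
    have hfar : a < ‖x₁'‖ := by
      have h1 : dist x₁' x₁ ≤ ‖x₁'‖ + ‖x₁‖ := by rw [dist_eq_norm]; exact norm_sub_le _ _
      linarith only [h1, not_le.1 h, hdist', hx₁half, ha]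
    have h3 := hoff x₁' hfar
    have hc' := hclose y₁' (hny₁'.trans hK1)
    rw [← hx₁'] at hc'
    have hsmall : ‖Vw⁻¹ • Q.symm (f x₁')‖ ≤ 3⁻¹ := by
      rw [norm_smul, LinearIsometryEquiv.norm_map, Real.norm_of_nonneg (inv_nonneg.2 hVw.le),
        inv_mul_le_iff₀ hVw]
      linarith only [h3, hVwV]
    have h4 := norm_sub_norm_le (W y₁') (Vw⁻¹ • Q.symm (f x₁'))
    rw [norm_sub_rev] at h4
    linarith only [h4, hc', hsmall, hnW', hWy₁, hKinv]
  -- consequences: the centre is near the axis, the antipode is inside the core region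
  have hcylc : cylRadius yc ≤ 3 * a / (2 * L) := by
    have h1 := cylRadius_le_cylRadius_add_norm_sub y₁ yc
    have h2 : cylRadius y₁ ≤ a / L := by rw [le_div_iff₀ hL]; linarith only [hpin]
    have h3 : a / L + a / (2 * L) = 3 * a / (2 * L) := by field_simp; ring
    linarith only [h1, h2, h3, hyc₁]
  have hx₁'D : ‖x₁'‖ < D := by
    have h1 : ‖x₁'‖ ≤ ‖x₁‖ + dist x₁' x₁ := by
      rw [dist_eq_norm]
      have := norm_add_le (x₁' - x₁) x₁
      rwa [sub_add_cancel, add_comm] at this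
    have h2 : dist x₁' x₁ ≤ 2 * a := by rw [hdist']; linarith only [hpin]
    linarith only [h1, h2, hx₁half, hDa, ha]
  -- suppose the core is long: the axis meets the shell inside the `K`-ball
  by_contra hcon
  push Not at hcon
  -- STEP 2: the on-axis shell point `ys`
  set σ : ℝ := yc 2 + 3 * D / (2 * L) with hσ
  set ys : EuclideanSpace ℝ (Fin 3) := σ • (eZ : EuclideanSpace ℝ (Fin 3)) with hys
  have hys0 : ys 0 = 0 := by simp [hys, eZ]
  have hys1 : ys 1 = 0 := by simp [hys, eZ]
  have hys2 : ys 2 = σ := by simp [hys, eZ]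
  clear_value ys
  have hysc : ‖ys - yc‖ ^ 2 = cylRadius yc ^ 2 + (3 * D / (2 * L)) ^ 2 := by
    rw [EuclideanSpace.real_norm_sq_eq, Fin.sum_univ_three, cylRadius_sq, PiLp.sub_apply, PiLp.sub_apply,
      PiLp.sub_apply, hys0, hys1, hys2, hσ]
    ring
  have hxs : x₀ + L • Q ys = L • Q (ys - yc) := by
    have h : x₀ + L • Q ys = (x₀ + L • Q yc) + L • Q (ys - yc) := by
      rw [map_sub, smul_sub]; abel
    rw [h, hphysc, zero_add]
  have hnxs : ‖x₀ + L • Q ys‖ = L * ‖ys - yc‖ := by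
    rw [hxs, norm_smul, LinearIsometryEquiv.norm_map, Real.norm_of_nonneg hL.le]
  have hDL : L * (3 * D / (2 * L)) = 3 * D / 2 := by field_simp
  have hlow : 3 * D / 2 ≤ L * ‖ys - yc‖ := by
    have h1 : (3 * D / (2 * L)) ^ 2 ≤ ‖ys - yc‖ ^ 2 := by
      rw [hysc]; exact le_add_of_nonneg_left (sq_nonneg _)
    have h2 : 3 * D / (2 * L) ≤ ‖ys - yc‖ :=
      (pow_le_pow_iff_left₀ (by positivity) (norm_nonneg _) two_ne_zero).1 h1
    calc 3 * D / 2 = L * (3 * D / (2 * L)) := hDL.symm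
      _ ≤ L * ‖ys - yc‖ := mul_le_mul_of_nonneg_left h2 hL.le
  have hup : L * ‖ys - yc‖ ≤ 3 * a / 2 + 3 * D / 2 := by
    have h3 : L * cylRadius yc ≤ 3 * a / 2 := by
      calc L * cylRadius yc ≤ L * (3 * a / (2 * L)) := mul_le_mul_of_nonneg_left hcylc hL.le
        _ = 3 * a / 2 := by field_simp
    have h4 : 0 ≤ L * cylRadius yc := mul_nonneg hL.le (cylRadius_nonneg _)
    have h1 : (L * ‖ys - yc‖) ^ 2 ≤ (3 * a / 2 + 3 * D / 2) ^ 2 := by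
      have h5 : (L * ‖ys - yc‖) ^ 2 = (L * cylRadius yc) ^ 2 + (3 * D / 2) ^ 2 := by
        rw [mul_pow, hysc, mul_add, ← mul_pow, ← mul_pow, hDL]
      rw [h5]
      nlinarith only [h3, h4, hD.le, ha.le]
    exact (pow_le_pow_iff_left₀ (mul_nonneg hL.le (norm_nonneg _)) (by positivity) two_ne_zero).1 h1
  have hfxs : f (x₀ + L • Q ys) = (V / 3) • EuclideanSpace.single 0 1 :=
    f3 _ (by rw [hnxs]; linarith only [hlow, hD]) (by rw [hnxs]; linarith only [hup, hDa, ha])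
  have hnys : ‖ys‖ ≤ K := by
    have h1 : ‖ys‖ ≤ ‖ys - yc‖ + ‖yc - y₁‖ + ‖y₁‖ := by
      have := norm_add₃_le (a := ys - yc) (b := yc - y₁) (c := y₁)
      rwa [sub_add_sub_cancel, sub_add_cancel] at this
    have h3 : L * ‖yc - y₁‖ ≤ a / 2 := by
      calc L * ‖yc - y₁‖ ≤ L * (a / (2 * L)) := mul_le_mul_of_nonneg_left hyc₁ hL.le
        _ = a / 2 := by field_simp
    have h4 : L * ‖y₁‖ ≤ L := by
      calc L * ‖y₁‖ ≤ L * 1 := mul_le_mul_of_nonneg_left hny₁ hL.le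
        _ = L := mul_one L
    have h2 : L * ‖ys‖ ≤ L * K := by
      have h5 : L * ‖ys‖ ≤ L * (‖ys - yc‖ + ‖yc - y₁‖ + ‖y₁‖) := mul_le_mul_of_nonneg_left h1 hL.le
      have h6 : L * (K - 1) = L * K - L := by ring
      linarith only [h5, h3, h4, hup, hcon, hDa, h6]
    exact le_of_mul_le_mul_left h2 hL
  -- on the axis the profile is vertical; closeness at `ys` pins `b = Q⁻¹ e_x` near the vertical
  have hW0 : W ys 0 = 0 := apply_zero_eq_zero_of_onAxis hW hys0 hys1
  have hW1 : W ys 1 = 0 := apply_one_eq_zero_of_onAxis hW hys0 hys1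
  have hc6 : 6⁻¹ ≤ Vw⁻¹ * (V / 3) := by rw [le_inv_mul_iff₀ hVw]; linarith only [hVw2]
  have hcs : ‖(Vw⁻¹ * (V / 3)) • b - W ys‖ ≤ K⁻¹ := by
    have h := hclose ys hnys
    rwa [hfxs, map_smul, smul_smul] at h
  have hb0 : |b 0| * K ≤ 6 := abs_apply_mul_le_six hK0 hc6 hcs hW0
  have hb1 : |b 1| * K ≤ 6 := abs_apply_mul_le_six hK0 hc6 hcs hW1
  -- STEP 3: the antipode of the near-maximum point; `f x₁'` is a nonnegative multiple of `e_z`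
  obtain ⟨g₂, hg₂0, hfx₁'⟩ : ∃ g₂ : ℝ, 0 ≤ g₂ ∧ f x₁' = (V * g₂) • (eZ : EuclideanSpace ℝ (Fin 3)) := by
    by_cases h : ‖x₁'‖ ≤ a
    · exact ⟨max 0 (1 - ‖x₁'‖ / a), le_max_left _ _, f1 _ h⟩
    · exact ⟨0, le_rfl, by rw [mul_zero, zero_smul]; exact f2 _ (not_le.1 h) hx₁'D⟩
  have hγ₂0 : 0 ≤ Vw⁻¹ * (V * g₂) := by positivity
  have hc₂ : ‖(Vw⁻¹ * (V * g₂)) • aa - W y₁'‖ ≤ K⁻¹ := by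
    have h := hclose y₁' (hny₁'.trans hK1)
    rwa [← hx₁', hfx₁', map_smul, smul_smul] at h
  have hflip0 : W y₁' 0 = -(W y₁ 0) := by rw [hWrot]; simp
  have hflip1 : W y₁' 1 = -(W y₁ 1) := by rw [hWrot]; simp
  have haa0 : |aa 0| * K ≤ 4 := abs_apply_mul_le_four hK0 hγ₁half hγ₂0 hc₁ hc₂ hflip0
  have haa1 : |aa 1| * K ≤ 4 := abs_apply_mul_le_four hK0 hγ₁half hγ₂0 hc₁ hc₂ hflip1
  -- STEP 4: two orthonormal vectors cannot both be that close to vertical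
  exact false_of_orthonormal_nearVertical hK haa hb hab haa0 haa1 hb0 hb1

end MonopoleAnchorObstruction

end Summit.NavierStokesRegularity.NavierStokesRegularity.Theorems

end
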